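import Summits.Ventures.CertifiedManyBodySolver.Downfold.UPinnedPairRowKernel
import Summits.Ventures.CertifiedManyBodySolver.Theorems.CovHg1201M19P10BundleWNClosers
import Summits.Ventures.CertifiedManyBodySolver.Certificates.HubbardSquare_Hg1201P10_gsDoccCeilings
import HarnessLib
import HarnessLib.Audit

/-!
# Ventures/CertifiedManyBodySolver — Theorems/CovHg1201M19P10LeftEdgeOfKernelPairs.lean: «PatchLeftEdgeP10» (stmt-Ventures-27104, route
# `CovHg1201M19P10`, HgBa₂CuO₄₊δ «Hg-1201» @10 GPa column, t′ = −49/100, n = 22/25) FROM PINNED U-PAIR SHAPES and FROM KERNEL PAIR RESIDUALS — tier-P closers generic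
# in every certificate literal

HONEST FRAMING: one-sided certified stiffness-scale CEILING closers on the DOWNFOLDED Hg-1201-labelled one-band box (D-0154 (1)(C) COVERAGE; wording
class (xx1): CONTROL / CALIBRATION); a ceiling never speaks to the presence of superconductivity or to `ρ_s = 0`; never «certified true negative»; not a `T_c` /
phase / pressure sentence; nothing about HgBa₂CuO₄₊δ samples. The theorems below are CONDITIONAL on hypotheses of three kinds ONLY: (a) a state-level
PINNED U-PAIR SHAPE `SquareTTPrimePinnedPairRowU` per U-cell (§1–§2) — or, in §3, hubbard-obs-p2-class exporter DATA (term lists over one letter type on a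
window `Λ' ⊇ box 2 7`, ONE shared eom word list `EB` for the three vertices) with per-window dictionary equations and per vertex ONE `decide`-class kernel
inequality `β_v ≤ lowerConst R_v + (μ_v 0 + μ_v 1)(11/25 − ν_v)`; (b) `norm_num`-class literal checks (multiplier signs, node caps vs the node-free
window functions, the law's `L` and floor kind, three strip prices against bar″ `4767609/10⁷`, the docc-ceiling arithmetic); (c) nothing else. NO claim node,
NO `@[conjecture]`, NO number of record is used or moved; nothing is evaluated here (no exporter output exists for Hg-1201 at this writing — kit-side);
the registry words of record (@10 column: `[3, 5]` 0.4715280, `[5, 17/2]` thick-strip slot 0.4666709), tiers, margins and the HOLD asked on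
stmt-Ventures-27104 are UNCHANGED; «closed modulo nodes» ≠ proved; no summit statement is proved by this file. ZERO compute, no definition, no `sorry`.

Cell `hubbard-obs` (D-0154 (1)(C) Hg-1201), seat hubbard-cov-hg1201-box-2 g3 (`prover-hubbard-cov-hg1201-box-2-g3-0`), typist / lineage desk. The @10-column
twin of this seat's `Theorems/CovHg1201M19LeftEdgeOfKernelPairs.lean` (M19 column) and of hubbard-cov-la214-unc-2's `Theorems/CovLa214M2bItemsOfKernelPairs.lean` (p670443).

THE CHAIN TYPED HERE (every link a tree theorem): [§3] exporter data ×3 with ONE `EB` → `SquareTTPrimePinnedPairRowU.of_residPolys_wide` ×2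
(`Downfold/UPinnedPairRowKernel.lean`, this seat; through hubbard-obs-p2's `CARPolyWindow.windowIdentity_of_residPoly` and the two-coupling core
`pinnedVertexRow₂_of_windowIdentity` p669140) → [§1] box-1's boxdual law `SquareTTPrimePinnedPairRowU.bundleWND_vertex / _interior` (p660744; docc box
`[0, 1/4]`) → `SquareTTPrimeBundleOrbitLowerRowWND.orbitLowerBoxRowW_thick_rat` with the GS docc ceiling DISCHARGED by box-2 g1's
`hg1201P10_gsDocc_le_quarter_of_cap_le` (p636690) under the node-free window functions of box-2 g1's `Theorems/CovHg1201M19P10BundleWNClosers.lean`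
(kinematic floor; @10 top HF plane `−15830689/10⁷ + U·121/625` on cells with `3 ≤ U₁`, or a polarised constant `c`) → box-2 g1's
`covHg1201M19P10_leftEdgeSegment_of_boxRowW` (p646715) → [§2] `covHg1201M19P10_PatchLeftEdgeP10_of_twoCells`. The rung leaf would follow by the landed
`Hg1201M19P10_StiffnessBoxCeiling_of_threeNodes`-shape glue once the K2″ bottom pair has its own kernel twin (t′-axis, box-1 g3's lane).

References: T. Koma, H. Tasaki, J. Stat. Phys. 76 (1994) 745 §1 [KomaTasaki1994]; D. J. Scalapino, S. R. White, S.-C. Zhang, PRB 47 (1993) 7995 §II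
[ScalapinoWhiteZhang1993]; J. Wang et al., PRX 14 (2024) 031006 §III [WangEtAl2024]; S. Boyd, L. Vandenberghe, *Convex Optimization* (2004) §5.9
[BoydVandenberghe2004]; D. P. Bertsekas, *Nonlinear Programming* (1999) Prop. 5.1.3 [Bertsekas1999NonlinearProgramming]; C. Jansson, D. Chaykin,
C. Keil, SIAM J. Numer. Anal. 46 (2008) 180 [JanssonChaykinKeil2008]; D. Ruelle, *Statistical Mechanics* (1969) §3.4 [Ruelle1969].
-/

noncomputable section

namespace Summit.Ventures.CertifiedManyBodySolver.Theorems

open Summit.Ventures.CertifiedManyBodySolver.Theses.CovHg1201M19P10 (PatchLeftEdgeP10)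
open Summit.Ventures.CertifiedManyBodySolver.Downfold Summit.Ventures.CertifiedManyBodySolver.Certificates
open Summit.Ventures.CertifiedManyBodySolver.Observables Summit.Ventures.CertifiedManyBodySolver
open Summit.Ventures.CertifiedQuantumChemistry Summit.Ventures.CertifiedQuantumChemistry.CARPoly
open Summit.Ventures.CertifiedManyBodySolver.CARPolyWindow
open Literature.MathematicalPhysics.QuantumManyBody.StateRelaxation
open Literature.MathematicalPhysics.QuantumLattice Literature.MathematicalPhysics.QuantumLattice.ThermodynamicLimit
open Literature.Probability.LatticeModels
open Matrix Set Filter Topology HubbardWave0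
open scoped BigOperators ComplexOrder

/-! ## §0 Local helpers (private copies of the M19-strip one-liners of `CovHg1201M19BundleWNClosers`, to keep the @10 route cone free of the M19 route file) -/

section Helpers
/-- The STRIP SLOT `min F (min (F + sl₁·(43/50 − 22/25)) (F + sl₂·(43/50 − 22/25)))` is below the four end values. [folklore] -/
private theorem p10k_bundleWNStripSlot_le (F sl₁ sl₂ : ℚ) :
    (min F (min (F + sl₁ * (43 / 50 - 22 / 25)) (F + sl₂ * (43 / 50 - 22 / 25)))) ≤ F + sl₁ * (43 / 50 - 22 / 25) ∧
    (min F (min (F + sl₁ * (43 / 50 - 22 / 25)) (F + sl₂ * (43 / 50 - 22 / 25)))) ≤ F + sl₁ * (22 / 25 - 22 / 25) ∧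
    (min F (min (F + sl₁ * (43 / 50 - 22 / 25)) (F + sl₂ * (43 / 50 - 22 / 25)))) ≤ F + sl₂ * (43 / 50 - 22 / 25) ∧
    (min F (min (F + sl₁ * (43 / 50 - 22 / 25)) (F + sl₂ * (43 / 50 - 22 / 25)))) ≤ F + sl₂ * (22 / 25 - 22 / 25) := by
  refine ⟨(min_le_right _ _).trans (min_le_left _ _), ?_, (min_le_right _ _).trans (min_le_right _ _), ?_⟩ <;>
    · simp only [sub_self, mul_zero, add_zero]; exact min_le_left _ _

/-- The PRICE of the strip slot from the three end prices. [folklore] -/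
private theorem p10k_neg_bundleWNStripSlot_le {F sl₁ sl₂ c : ℚ} (p₀ : -F ≤ c) (p₁ : -F - sl₁ * (43 / 50 - 22 / 25) ≤ c)
    (p₂ : -F - sl₂ * (43 / 50 - 22 / 25) ≤ c) :
    -(((min F (min (F + sl₁ * (43 / 50 - 22 / 25)) (F + sl₂ * (43 / 50 - 22 / 25)))) : ℚ) : ℝ) ≤ ((c : ℚ) : ℝ) := by
  have h : -((min F (min (F + sl₁ * (43 / 50 - 22 / 25)) (F + sl₂ * (43 / 50 - 22 / 25))))) ≤ c := by
    rcases min_choice F (min (F + sl₁ * (43 / 50 - 22 / 25)) (F + sl₂ * (43 / 50 - 22 / 25))) with h | h <;> rw [h]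
    · linarith
    · rcases min_choice (F + sl₁ * (43 / 50 - 22 / 25)) (F + sl₂ * (43 / 50 - 22 / 25)) with h' | h' <;> rw [h'] <;> linarith
  exact_mod_cast h
end Helpers

/-! ## §1 ONE left U-cell `[U₁, U₂] × {t′ = −49/100} × n ∈ [43/50, 22/25]` from ONE pinned U-pair SHAPE -/

section Cell

/-- **PAIR SHAPE ⇒ DOCC-BOX ROW on a left @10 U-cell, both floor kinds at once.** The boxdual law `bundleWND_vertex` (`L ≤ 0`, slot `F ≤ min βA βB`) /
`bundleWND_interior` (`0 < L`, slot below the completed square) with the reader literal `dhi = 1/4`; window FUNCTIONS under the chords of the vertex rhs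
(division-free). Every literal hypothesis is `norm_num`-class at an instance. [cite: Bertsekas1999NonlinearProgramming, Prop. 5.1.3] [cite: BoydVandenberghe2004, §5.9] -/
theorem covHg1201M19P10_leftWND_of_pairU {U₁ U₂ : ℝ} (h12 : U₁ < U₂) {flo cap : ℝ → ℝ → ℝ}
    {cA cB flA flB βA κA κA' slA βB κB κB' slB F L : ℚ} {X : FermionOp (box 2 7)}
    (h : SquareTTPrimePinnedPairRowU U₁ U₂ (-49 / 100) cA cB flA flB βA κA κA' slA βB κB κB' slB (22 / 25) Finset.univ (box 2 7) X)
    (hκA : 0 ≤ κA) (hκA' : 0 ≤ κA') (hκB : 0 ≤ κB) (hκB' : 0 ≤ κB')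
    (hcap : ∀ U ∈ Set.Icc U₁ U₂, ∀ s' ∈ Set.Icc (-49 / 100 : ℝ) (-49 / 100),
      (U₂ - U₁) * cap U s' ≤ (U₂ - U) * ((cA : ℚ) : ℝ) + (U - U₁) * ((cB : ℚ) : ℝ))
    (hflo : ∀ U ∈ Set.Icc U₁ U₂, ∀ s' ∈ Set.Icc (-49 / 100 : ℝ) (-49 / 100),
      (U₂ - U) * ((flA : ℚ) : ℝ) + (U - U₁) * ((flB : ℚ) : ℝ) ≤ (U₂ - U₁) * flo U s')
    (hLdef : ((L : ℚ) : ℝ) = (U₂ - U₁) * max ((((κB - κA) - (κB' - κA') : ℚ) : ℝ) * 0)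
        ((((κB - κA) - (κB' - κA') : ℚ) : ℝ) * (((1 / 4 : ℚ)) : ℝ)) -
          ((((κB - κA) * (cB - cA) + (κB' - κA') * (-(flB - flA)) : ℚ)) : ℝ))
    (hFv : L ≤ 0 → F ≤ min βA βB)
    (hFi : 0 < L → ((F : ℚ) : ℝ) ≤ ((βA : ℚ) : ℝ) - (((L : ℚ) : ℝ) - (((βB : ℚ) : ℝ) - ((βA : ℚ) : ℝ))) ^ 2 / (4 * ((L : ℚ) : ℝ))) :
    SquareTTPrimeBundleOrbitLowerRowWND U₁ U₂ (-49 / 100) (-49 / 100) flo cap (1 / 4) F slA slB (22 / 25) Finset.univ (box 2 7) X := by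
  rcases le_or_gt L 0 with hL | hL
  · exact h.bundleWND_vertex h12 hκA hκA' hκB hκB' hcap hflo hLdef (by exact_mod_cast hL) (hFv hL)
  · exact h.bundleWND_interior h12 hκA hκA' hκB hκB' hcap hflo hLdef (by exact_mod_cast hL) (hFi hL)

/-- **LEFT-EDGE FAMILY ON A LOW-`U` CELL `[U₁, U₂]`, `3 ≤ U₁`, FROM ONE PINNED U-PAIR SHAPE** (corner objective `−X₀(−49/100; Uo)`, solved at `22/25`): the two
vertex cap literals lie ON OR ABOVE the top HF plane `−15830689/10⁷ + U·121/625` at the cell ends, the two cut floors at or below the kinematic constant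
`−124827703/5·10⁷`; docc box `[0, 1/4]` DISCHARGED on the thick cell by `hg1201P10_gsDocc_le_quarter_of_cap_le` (`cap + 1.5861979 ≤ U/4` holds on the plane for
`U ≥ 3`); the law's `L` and floor kind; three strip prices `−F ≤ bar′`, `−F − sl_v·(43/50 − 22/25) ≤ bar′`. Then the @10 left-edge family holds at every
`U′ ∈ [U₁, U₂]`, `n ∈ [43/50, 22/25]`, `σ ∈ [−49/100, −47/100]`. [cite: ScalapinoWhiteZhang1993, §II] [cite: BoydVandenberghe2004, §5.9] [cite: Ruelle1969, §3.4] -/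
theorem covHg1201M19P10_leftEdgeStripCell_of_pairU_topPlane {U₁ U₂ : ℝ} (hU₁ : 3 ≤ U₁) (h12 : U₁ < U₂) (Uo : ℝ)
    {cA cB flA flB βA κA κA' slA βB κB κB' slB F L : ℚ}
    (h : SquareTTPrimePinnedPairRowU U₁ U₂ (-49 / 100) cA cB flA flB βA κA κA' slA βB κB κB' slB (22 / 25) Finset.univ (box 2 7)
      (-oddMomentObsTT (-49 / 100) Uo 0))
    (hκA : 0 ≤ κA) (hκA' : 0 ≤ κA') (hκB : 0 ≤ κB) (hκB' : 0 ≤ κB')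
    (hcA : ((-15830689/10000000 : ℚ) : ℝ) + U₁ * ((121/625 : ℚ) : ℝ) ≤ ((cA : ℚ) : ℝ))
    (hcB : ((-15830689/10000000 : ℚ) : ℝ) + U₂ * ((121/625 : ℚ) : ℝ) ≤ ((cB : ℚ) : ℝ))
    (hflA : flA ≤ -124827703/50000000) (hflB : flB ≤ -124827703/50000000)
    (hLdef : ((L : ℚ) : ℝ) = (U₂ - U₁) * max ((((κB - κA) - (κB' - κA') : ℚ) : ℝ) * 0)
        ((((κB - κA) - (κB' - κA') : ℚ) : ℝ) * (((1 / 4 : ℚ)) : ℝ)) -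
          ((((κB - κA) * (cB - cA) + (κB' - κA') * (-(flB - flA)) : ℚ)) : ℝ))
    (hFv : L ≤ 0 → F ≤ min βA βB)
    (hFi : 0 < L → ((F : ℚ) : ℝ) ≤ ((βA : ℚ) : ℝ) - (((L : ℚ) : ℝ) - (((βB : ℚ) : ℝ) - ((βA : ℚ) : ℝ))) ^ 2 / (4 * ((L : ℚ) : ℝ)))
    (p₀ : -F ≤ 4767609 / 10000000) (p₁ : -F - slA * (43 / 50 - 22 / 25) ≤ 4767609 / 10000000)
    (p₂ : -F - slB * (43 / 50 - 22 / 25) ≤ 4767609 / 10000000) :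
    ∀ n ∈ Set.Icc (43 / 50 : ℝ) (22 / 25), ∀ σ ∈ Set.Icc (-49 / 100 : ℝ) (-47 / 100), ∀ U' ∈ Set.Icc U₁ U₂,
      ∀ (ω : InfVolFermionState 2) (Ls : ℕ → ℕ) (ψ : ∀ L, Fock (Orb (FermionTorus 2 L))),
      Tendsto Ls atTop atTop →
      (∀ j, IsGroundStateInSector (hubbardTorusTT' (Ls j) 1 (-49 / 100) U') (rectN n (Ls j)) 0 (ψ (Ls j))) →
      (∀ j, star (ψ (Ls j)) ⬝ᵥ ψ (Ls j) = 1) → ω.IsTorusLimitOf ψ Ls →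
      -(4767609 / 10000000 : ℝ) ≤ ((Finset.univ : Finset (DihedralGroup 4)).card : ℝ)⁻¹ * ∑ g ∈ (Finset.univ : Finset (DihedralGroup 4)),
        (ω.expect (d4ShiftSet g 0 (box 2 7)) (fermionEmbed (PolySite.d4Emb g 0 (box 2 7)) (-oddMomentObsTT σ U' 0))).re := by
  have hflA' : ((flA : ℚ) : ℝ) ≤ (((-124827703/50000000 : ℚ)) : ℝ) := by exact_mod_cast hflA
  have hflB' : ((flB : ℚ) : ℝ) ≤ (((-124827703/50000000 : ℚ)) : ℝ) := by exact_mod_cast hflB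
  -- (1) the docc-box row on the cell, window functions = kinematic floor / top HF plane
  have hW : SquareTTPrimeBundleOrbitLowerRowWND U₁ U₂ (-49 / 100) (-49 / 100) (fun (_ _ : ℝ) => (((-124827703/50000000 : ℚ)) : ℝ))
      (fun (U _ : ℝ) => ((-15830689/10000000 : ℚ) : ℝ) + U * ((121/625 : ℚ) : ℝ)) (1 / 4) F slA slB (22 / 25) Finset.univ (box 2 7)
      (-oddMomentObsTT (-49 / 100) Uo 0) := by
    refine covHg1201M19P10_leftWND_of_pairU h12 h hκA hκA' hκB hκB' ?_ ?_ hLdef hFv hFi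
    · intro U hU s' _
      nlinarith [mul_nonneg (sub_nonneg.2 hU.2) (sub_nonneg.2 hcA), mul_nonneg (sub_nonneg.2 hU.1) (sub_nonneg.2 hcB)]
    · intro U hU s' _
      nlinarith [mul_nonneg (sub_nonneg.2 hU.2) (sub_nonneg.2 hflA'), mul_nonneg (sub_nonneg.2 hU.1) (sub_nonneg.2 hflB')]
  -- (2) the thick box window row, docc ceiling discharged on the cell
  obtain ⟨a, b, c, d⟩ := p10k_bundleWNStripSlot_le F slA slB
  have hrow := hW.orbitLowerBoxRowW_thick_rat (n₁ := 43 / 50) (n₂ := 22 / 25) (by norm_num) (by norm_num)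
    (fun U hU s hs x hx ω Ls ψ hLs hψ h1 hω hcapx => by
      obtain rfl : s = -49 / 100 := le_antisymm hs.2 hs.1
      have hx1 : (43 / 50 : ℝ) ≤ x := by have e := hx.1; push_cast at e; exact e
      have hx2 : x ≤ (22 / 25 : ℝ) := by have e := hx.2; push_cast at e; exact e
      exact (hg1201P10_gsDocc_le_quarter_of_cap_le (by linarith [hU.1]) (by linarith) (by linarith) hcapx
        (by push_cast; linarith [hU.1]) ω Ls ψ hLs hψ h1 hω).trans (by norm_num)) a b c d
  have e1 : (((43 / 50 : ℚ)) : ℝ) = 43 / 50 := by norm_num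
  have e2 : (((22 / 25 : ℚ)) : ℝ) = 22 / 25 := by norm_num
  rw [e1, e2] at hrow
  -- (3) prices and the family
  have hr := p10k_neg_bundleWNStripSlot_le p₀ p₁ p₂
  have e : (((4767609 / 10000000 : ℚ)) : ℝ) = (4767609 / 10000000 : ℝ) := by norm_num
  rw [e] at hr
  exact covHg1201M19P10_leftEdgeSegment_of_boxRowW (by norm_num) le_rfl Uo hrow (covHg1201M19P10_leftThickCell_kinFloorFn (by linarith))
    (covHg1201M19P10_leftThickCell_topPlaneCap (by linarith)) hr

/-- **LEFT-EDGE FAMILY ON A CONSTANT-CAP CELL `[U₁, U₂]`, `0 < U₁`, FROM ONE PINNED U-PAIR SHAPE RE-PRICED TO THE CELL CAP**: a polarised constant `c`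
above both strip-end rows (`hc₁`, `hc₂`, `covHg1201M19P10_leftThickCell_constCap_of_polCaps`) that IS the cap literal of both vertices (apply `.reprice c c` first —
an identity: `β ↦ β − κ_cap·(c − c_solved)`); docc box discharged by `c + 1.5861979 ≤ U₁/4`; the rest as in the top-plane edition.
[cite: ScalapinoWhiteZhang1993, §II] [cite: BoydVandenberghe2004, §5.9] [cite: Ruelle1969, §3.4] -/
theorem covHg1201M19P10_leftEdgeStripCell_of_pairU_constCap {U₁ U₂ : ℝ} (hU₁ : 0 < U₁) (h12 : U₁ < U₂) (Uo : ℝ)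
    {c flA flB βA κA κA' slA βB κB κB' slB F L : ℚ}
    (hc₁ : (-6148940299/10000000000 : ℚ) ≤ c) (hc₂ : (-5511249107/10000000000 : ℚ) ≤ c)
    (hcU : ((c : ℚ) : ℝ) + 15861979 / 10000000 ≤ U₁ / 4)
    (h : SquareTTPrimePinnedPairRowU U₁ U₂ (-49 / 100) c c flA flB βA κA κA' slA βB κB κB' slB (22 / 25) Finset.univ (box 2 7)
      (-oddMomentObsTT (-49 / 100) Uo 0))
    (hκA : 0 ≤ κA) (hκA' : 0 ≤ κA') (hκB : 0 ≤ κB) (hκB' : 0 ≤ κB')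
    (hflA : flA ≤ -124827703/50000000) (hflB : flB ≤ -124827703/50000000)
    (hLdef : ((L : ℚ) : ℝ) = (U₂ - U₁) * max ((((κB - κA) - (κB' - κA') : ℚ) : ℝ) * 0)
        ((((κB - κA) - (κB' - κA') : ℚ) : ℝ) * (((1 / 4 : ℚ)) : ℝ)) -
          ((((κB - κA) * (c - c) + (κB' - κA') * (-(flB - flA)) : ℚ)) : ℝ))
    (hFv : L ≤ 0 → F ≤ min βA βB)
    (hFi : 0 < L → ((F : ℚ) : ℝ) ≤ ((βA : ℚ) : ℝ) - (((L : ℚ) : ℝ) - (((βB : ℚ) : ℝ) - ((βA : ℚ) : ℝ))) ^ 2 / (4 * ((L : ℚ) : ℝ)))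
    (p₀ : -F ≤ 4767609 / 10000000) (p₁ : -F - slA * (43 / 50 - 22 / 25) ≤ 4767609 / 10000000)
    (p₂ : -F - slB * (43 / 50 - 22 / 25) ≤ 4767609 / 10000000) :
    ∀ n ∈ Set.Icc (43 / 50 : ℝ) (22 / 25), ∀ σ ∈ Set.Icc (-49 / 100 : ℝ) (-47 / 100), ∀ U' ∈ Set.Icc U₁ U₂,
      ∀ (ω : InfVolFermionState 2) (Ls : ℕ → ℕ) (ψ : ∀ L, Fock (Orb (FermionTorus 2 L))),
      Tendsto Ls atTop atTop →
      (∀ j, IsGroundStateInSector (hubbardTorusTT' (Ls j) 1 (-49 / 100) U') (rectN n (Ls j)) 0 (ψ (Ls j))) →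
      (∀ j, star (ψ (Ls j)) ⬝ᵥ ψ (Ls j) = 1) → ω.IsTorusLimitOf ψ Ls →
      -(4767609 / 10000000 : ℝ) ≤ ((Finset.univ : Finset (DihedralGroup 4)).card : ℝ)⁻¹ * ∑ g ∈ (Finset.univ : Finset (DihedralGroup 4)),
        (ω.expect (d4ShiftSet g 0 (box 2 7)) (fermionEmbed (PolySite.d4Emb g 0 (box 2 7)) (-oddMomentObsTT σ U' 0))).re := by
  have hflA' : ((flA : ℚ) : ℝ) ≤ (((-124827703/50000000 : ℚ)) : ℝ) := by exact_mod_cast hflA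
  have hflB' : ((flB : ℚ) : ℝ) ≤ (((-124827703/50000000 : ℚ)) : ℝ) := by exact_mod_cast hflB
  -- (1) the docc-box row on the cell, window functions = kinematic floor / constant `c`
  have hW : SquareTTPrimeBundleOrbitLowerRowWND U₁ U₂ (-49 / 100) (-49 / 100) (fun (_ _ : ℝ) => (((-124827703/50000000 : ℚ)) : ℝ))
      (fun (_ _ : ℝ) => ((c : ℚ) : ℝ)) (1 / 4) F slA slB (22 / 25) Finset.univ (box 2 7) (-oddMomentObsTT (-49 / 100) Uo 0) := by
    refine covHg1201M19P10_leftWND_of_pairU h12 h hκA hκA' hκB hκB' ?_ ?_ hLdef hFv hFi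
    · intro U hU s' _
      linarith
    · intro U hU s' _
      nlinarith [mul_nonneg (sub_nonneg.2 hU.2) (sub_nonneg.2 hflA'), mul_nonneg (sub_nonneg.2 hU.1) (sub_nonneg.2 hflB')]
  -- (2) the thick box window row, docc ceiling discharged on the cell
  obtain ⟨a, b, c', d⟩ := p10k_bundleWNStripSlot_le F slA slB
  have hrow := hW.orbitLowerBoxRowW_thick_rat (n₁ := 43 / 50) (n₂ := 22 / 25) (by norm_num) (by norm_num)
    (fun U hU s hs x hx ω Ls ψ hLs hψ h1 hω hcapx => by
      obtain rfl : s = -49 / 100 := le_antisymm hs.2 hs.1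
      have hx1 : (43 / 50 : ℝ) ≤ x := by have e := hx.1; push_cast at e; exact e
      have hx2 : x ≤ (22 / 25 : ℝ) := by have e := hx.2; push_cast at e; exact e
      exact (hg1201P10_gsDocc_le_quarter_of_cap_le (by linarith [hU.1]) (by linarith) (by linarith) hcapx
        (by linarith [hU.1]) ω Ls ψ hLs hψ h1 hω).trans (by norm_num)) a b c' d
  have e1 : (((43 / 50 : ℚ)) : ℝ) = 43 / 50 := by norm_num
  have e2 : (((22 / 25 : ℚ)) : ℝ) = 22 / 25 := by norm_num
  rw [e1, e2] at hrow
  -- (3) prices and the family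
  have hr := p10k_neg_bundleWNStripSlot_le p₀ p₁ p₂
  have e : (((4767609 / 10000000 : ℚ)) : ℝ) = (4767609 / 10000000 : ℝ) := by norm_num
  rw [e] at hr
  exact covHg1201M19P10_leftEdgeSegment_of_boxRowW (by norm_num) le_rfl Uo hrow (covHg1201M19P10_leftThickCell_kinFloorFn hU₁.le)
    (covHg1201M19P10_leftThickCell_constCap_of_polCaps hU₁.le hc₁ hc₂) hr

end Cell

/-! ## §2 THE ITEM from TWO pinned U-pair shapes (cells `[3, b]` top plane, `[b, 17/2]` constant cap) -/

section Item

/-- **«PatchLeftEdgeP10» (stmt-Ventures-27104) FROM TWO PINNED U-PAIR SHAPES** on `[3, b]` (vertex caps on/above the top HF plane) and `[b, 17/2]`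
(re-priced to the polarised constant cap `c`), every certificate literal generic, every side condition `norm_num`-class; glue
`covHg1201M19P10_PatchLeftEdgeP10_of_twoCells`. With `b = 5`, `c = −5511249107/10¹⁰` and the literals of the PAIR siblings p671532 / p677531 (`.reprice c c` on the second)
this is the lineage-5 reading of the column's two U-cell nodes of record.
[cite: KomaTasaki1994, §1] [cite: ScalapinoWhiteZhang1993, §II] [cite: BoydVandenberghe2004, §5.9] -/
theorem covHg1201M19P10_PatchLeftEdgeP10_of_pairU_twoCells {b : ℝ} (hb₁ : 3 < b) (hb₂ : b < 17 / 2) (Uo₁ Uo₂ : ℝ)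
    -- cell 1 = [3, b], top-plane caps
    {cA cB flA flB βA κA κA' slA βB κB κB' slB F₁ L₁ : ℚ}
    (h₁ : SquareTTPrimePinnedPairRowU (3) b (-49 / 100) cA cB flA flB βA κA κA' slA βB κB κB' slB (22 / 25) Finset.univ (box 2 7)
      (-oddMomentObsTT (-49 / 100) Uo₁ 0))
    (hκA : 0 ≤ κA) (hκA' : 0 ≤ κA') (hκB : 0 ≤ κB) (hκB' : 0 ≤ κB')
    (hcA : ((-15830689/10000000 : ℚ) : ℝ) + (3 : ℝ) * ((121/625 : ℚ) : ℝ) ≤ ((cA : ℚ) : ℝ))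
    (hcB : ((-15830689/10000000 : ℚ) : ℝ) + b * ((121/625 : ℚ) : ℝ) ≤ ((cB : ℚ) : ℝ))
    (hflA : flA ≤ -124827703/50000000) (hflB : flB ≤ -124827703/50000000)
    (hL₁ : ((L₁ : ℚ) : ℝ) = (b - 3) * max ((((κB - κA) - (κB' - κA') : ℚ) : ℝ) * 0)
        ((((κB - κA) - (κB' - κA') : ℚ) : ℝ) * (((1 / 4 : ℚ)) : ℝ)) -
          ((((κB - κA) * (cB - cA) + (κB' - κA') * (-(flB - flA)) : ℚ)) : ℝ))
    (hF₁v : L₁ ≤ 0 → F₁ ≤ min βA βB)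
    (hF₁i : 0 < L₁ → ((F₁ : ℚ) : ℝ) ≤ ((βA : ℚ) : ℝ) - (((L₁ : ℚ) : ℝ) - (((βB : ℚ) : ℝ) - ((βA : ℚ) : ℝ))) ^ 2 / (4 * ((L₁ : ℚ) : ℝ)))
    (p₀ : -F₁ ≤ 4767609 / 10000000) (p₁ : -F₁ - slA * (43 / 50 - 22 / 25) ≤ 4767609 / 10000000)
    (p₂ : -F₁ - slB * (43 / 50 - 22 / 25) ≤ 4767609 / 10000000)
    -- cell 2 = [b, 17/2], constant cap `c` (shape re-priced to `c` at both vertices)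
    {c flC flD βC κC κC' slC βD κD κD' slD F₂ L₂ : ℚ}
    (hc₁ : (-6148940299/10000000000 : ℚ) ≤ c) (hc₂ : (-5511249107/10000000000 : ℚ) ≤ c)
    (hcU : ((c : ℚ) : ℝ) + 15861979 / 10000000 ≤ b / 4)
    (h₂ : SquareTTPrimePinnedPairRowU b (17 / 2) (-49 / 100) c c flC flD βC κC κC' slC βD κD κD' slD (22 / 25) Finset.univ (box 2 7)
      (-oddMomentObsTT (-49 / 100) Uo₂ 0))
    (hκC : 0 ≤ κC) (hκC' : 0 ≤ κC') (hκD : 0 ≤ κD) (hκD' : 0 ≤ κD')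
    (hflC : flC ≤ -124827703/50000000) (hflD : flD ≤ -124827703/50000000)
    (hL₂ : ((L₂ : ℚ) : ℝ) = (17 / 2 - b) * max ((((κD - κC) - (κD' - κC') : ℚ) : ℝ) * 0)
        ((((κD - κC) - (κD' - κC') : ℚ) : ℝ) * (((1 / 4 : ℚ)) : ℝ)) -
          ((((κD - κC) * (c - c) + (κD' - κC') * (-(flD - flC)) : ℚ)) : ℝ))
    (hF₂v : L₂ ≤ 0 → F₂ ≤ min βC βD)
    (hF₂i : 0 < L₂ → ((F₂ : ℚ) : ℝ) ≤ ((βC : ℚ) : ℝ) - (((L₂ : ℚ) : ℝ) - (((βD : ℚ) : ℝ) - ((βC : ℚ) : ℝ))) ^ 2 / (4 * ((L₂ : ℚ) : ℝ)))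
    (q₀ : -F₂ ≤ 4767609 / 10000000) (q₁ : -F₂ - slC * (43 / 50 - 22 / 25) ≤ 4767609 / 10000000)
    (q₂ : -F₂ - slD * (43 / 50 - 22 / 25) ≤ 4767609 / 10000000) :
    PatchLeftEdgeP10 :=
  covHg1201M19P10_PatchLeftEdgeP10_of_twoCells
    (covHg1201M19P10_leftEdgeStripCell_of_pairU_topPlane le_rfl hb₁ Uo₁ h₁ hκA hκA' hκB hκB' hcA hcB hflA hflB hL₁ hF₁v hF₁i p₀ p₁ p₂)
    (covHg1201M19P10_leftEdgeStripCell_of_pairU_constCap (by linarith) hb₂ Uo₂ hc₁ hc₂ hcU h₂ hκC hκC' hκD hκD' hflC hflD hL₂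
      hF₂v hF₂i q₀ q₁ q₂)

end Item

/-! ## §3 THE ITEM from KERNEL PAIR RESIDUALS: three vertices {P at `3`, Q at `b`, R at `17/2`}, ONE shared eom word list -/

section Kernel

variable {α β : Type*}

/-- **«PatchLeftEdgeP10» (stmt-Ventures-27104) FROM THREE SEMANTIC VERTEX RESIDUALS WITH ONE SHARED EOM WORD LIST** — the U-ladder {P = hub at `U = 3`,
Q = spoke at `U = b`, R = spoke at `U = 17/2`} at `t′ = −49/100`, solved at `n₀ = 22/25`, corner objective `−X₀(−49/100; Uo)` (ONE word, three term lists),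
on any letter window `Λ' ⊇ box 2 7`: per vertex the hubbard-obs-p2 residual data (`residTG` dictionaries `TH_v ↦ H^{(1,−49/100,U_v)}_{Λ'}`, `TE_v ↦ ΓE^{(1,−49/100,U_v)}`,
Gram term, moves, charged words, anti-Hermitian parts, ANY polynomial `R_v` denoting the residual) and ONE kernel inequality
`β_v ≤ lowerConst R_v + (μ_v 0 + μ_v 1)(11/25 − ν_v)` with the slope identity `μ_v 0 + μ_v 1 = 2·sl_v`. Cell 1 = {P, Q} RE-PRICED to the top-plane values
`cP♯ = −15830689/10⁷ + 3·121/625`, `cQ♯ = −15830689/10⁷ + b·121/625` (bounds `βP♯ ≤ βP − κP·(cP♯ − capP)`, `βQ♯ ≤ βQ − κQ·(cQ♯ − capQ)` — identities of the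
reader's re-pricing, then β-monotonicity); cell 2 = {Q, R} RE-PRICED to the polarised constant `c` (`βQ♭`, `βR♭` likewise); then the two cells' literal checks of
§2. Conclusion: the route decl `Theses.CovHg1201M19P10.PatchLeftEdgeP10` — NO claim node. Nothing is evaluated here (no exporter output exists for Hg-1201).
[cite: KomaTasaki1994, §1] [cite: WangEtAl2024, §III] [cite: JanssonChaykinKeil2008, §3] [cite: BoydVandenberghe2004, §5.9] -/
theorem covHg1201M19P10_PatchLeftEdgeP10_of_kernelTriple
    (b : ℚ) (hb₁ : 3 < b) (hb₂ : b < 17 / 2) (Uo : ℝ)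
    {Λ Λ' : Finset (Site 2)} (h7 : box 2 7 ⊆ Λ') (hΛ : Λ ⊆ Λ') (h8 : thicken Λ 1 ⊆ Λ')
    (h0 : thicken ({0} : Finset (Site 2)) 1 ⊆ Λ') (hz : (0 : Site 2) ∈ Λ')
    -- letters (shared)
    (d : α → Orb (PolySite Λ'))
    (dΛ : β → Orb (PolySite Λ)) (f : β → α) (hf : ∀ b', d (f b') = Orb.embMap (PolySite.incl hΛ) (dΛ b'))
    (sp : α → Fin 2) (hsp : ∀ a, (ofLex (d a)).2 = sp a)
    (o : Fin 2 → α) (ho : ∀ σ, d (o σ) = orb (PolySite.pt 0 hz) σ)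
    -- the SHARED eom words
    (EB : List (Terms β))
    -- vertex P (hub, `U = 3`)
    (THP : Terms α) (hHP : termOp d THP = (hubbardTTPrimeFermionInteraction 1 (((-49 / 100 : ℚ)) : ℝ) (((3 : ℚ)) : ℝ)).localHamiltonian Λ')
    (TEP : Terms α) (hEP : termOp d TEP =
      fermionEmbed (PolySite.incl h0) ((hubbardTTPrimeFermionInteraction 1 (((-49 / 100 : ℚ)) : ℝ) (((3 : ℚ)) : ℝ)).meanEnergyObs 1))
    (TXP : Terms α) (hXP : termOp d TXP = fermionEmbed (PolySite.incl h7) (-oddMomentObsTT (-49 / 100) Uo 0))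
    (μP : Fin 2 → ℚ) (νP κP capP κP' flP : ℚ)
    (TGP : Terms α) {mP : Type*} [Fintype mP] [DecidableEq mP] {ΛmP : Matrix mP mP ℂ} (hΛmP : ΛmP.PosSemidef)
    (OP : mP → FermionOp Λ') (hGP : termOp d TGP = gramForm ΛmP OP)
    {nSP : ℕ} (γP : Fin nSP → DihedralGroup 4) (wvP : Fin nSP → Site 2) (hshP : ∀ l, d4ShiftSet (γP l) (wvP l) Λ ⊆ Λ')
    (gP : Fin nSP → β → α)
    (hgP : ∀ l b', d (gP l b') = Orb.embMap (PolySite.incl (hshP l)) (Orb.embMap (PolySite.d4Emb (γP l) (wvP l) Λ) (dΛ b')))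
    (SYP : Fin nSP → Terms β) (CWP : Terms α) (hcwP : ∀ wc ∈ CWP, chargeW wc.1 ≠ 0 ∨ spinChargeW sp wc.1 ≠ 0) (AVP : List (Terms α))
    {RP : CARPoly.Poly α}
    (hRP : evalPoly d RP = termOp d (residTG TXP μP νP o κP capP κP' flP TEP TGP THP f EB gP SYP CWP AVP))
    {βP slP : ℚ} (hβP : βP ≤ lowerConst RP + (μP 0 + μP 1) * ((22 / 25 : ℚ) / 2 - νP)) (hslP : μP 0 + μP 1 = 2 * slP)
    -- vertex Q (spoke, `U = b`)
    (THQ : Terms α) (hHQ : termOp d THQ = (hubbardTTPrimeFermionInteraction 1 (((-49 / 100 : ℚ)) : ℝ) ((b : ℚ) : ℝ)).localHamiltonian Λ')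
    (TEQ : Terms α) (hEQ : termOp d TEQ =
      fermionEmbed (PolySite.incl h0) ((hubbardTTPrimeFermionInteraction 1 (((-49 / 100 : ℚ)) : ℝ) ((b : ℚ) : ℝ)).meanEnergyObs 1))
    (TXQ : Terms α) (hXQ : termOp d TXQ = fermionEmbed (PolySite.incl h7) (-oddMomentObsTT (-49 / 100) Uo 0))
    (μQ : Fin 2 → ℚ) (νQ κQ capQ κQ' flQ : ℚ)
    (TGQ : Terms α) {mQ : Type*} [Fintype mQ] [DecidableEq mQ] {ΛmQ : Matrix mQ mQ ℂ} (hΛmQ : ΛmQ.PosSemidef)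
    (OQ : mQ → FermionOp Λ') (hGQ : termOp d TGQ = gramForm ΛmQ OQ)
    {nSQ : ℕ} (γQ : Fin nSQ → DihedralGroup 4) (wvQ : Fin nSQ → Site 2) (hshQ : ∀ l, d4ShiftSet (γQ l) (wvQ l) Λ ⊆ Λ')
    (gQ : Fin nSQ → β → α)
    (hgQ : ∀ l b', d (gQ l b') = Orb.embMap (PolySite.incl (hshQ l)) (Orb.embMap (PolySite.d4Emb (γQ l) (wvQ l) Λ) (dΛ b')))
    (SYQ : Fin nSQ → Terms β) (CWQ : Terms α) (hcwQ : ∀ wc ∈ CWQ, chargeW wc.1 ≠ 0 ∨ spinChargeW sp wc.1 ≠ 0) (AVQ : List (Terms α))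
    {RQ : CARPoly.Poly α}
    (hRQ : evalPoly d RQ = termOp d (residTG TXQ μQ νQ o κQ capQ κQ' flQ TEQ TGQ THQ f EB gQ SYQ CWQ AVQ))
    {βQ slQ : ℚ} (hβQ : βQ ≤ lowerConst RQ + (μQ 0 + μQ 1) * ((22 / 25 : ℚ) / 2 - νQ)) (hslQ : μQ 0 + μQ 1 = 2 * slQ)
    -- vertex R (spoke, `U = 17/2`)
    (THR : Terms α) (hHR : termOp d THR = (hubbardTTPrimeFermionInteraction 1 (((-49 / 100 : ℚ)) : ℝ) (((17 / 2 : ℚ)) : ℝ)).localHamiltonian Λ')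
    (TER : Terms α) (hER : termOp d TER =
      fermionEmbed (PolySite.incl h0) ((hubbardTTPrimeFermionInteraction 1 (((-49 / 100 : ℚ)) : ℝ) (((17 / 2 : ℚ)) : ℝ)).meanEnergyObs 1))
    (TXR : Terms α) (hXR : termOp d TXR = fermionEmbed (PolySite.incl h7) (-oddMomentObsTT (-49 / 100) Uo 0))
    (μR : Fin 2 → ℚ) (νR κR capR κR' flR : ℚ)
    (TGR : Terms α) {mR : Type*} [Fintype mR] [DecidableEq mR] {ΛmR : Matrix mR mR ℂ} (hΛmR : ΛmR.PosSemidef)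
    (OR : mR → FermionOp Λ') (hGR : termOp d TGR = gramForm ΛmR OR)
    {nSR : ℕ} (γR : Fin nSR → DihedralGroup 4) (wvR : Fin nSR → Site 2) (hshR : ∀ l, d4ShiftSet (γR l) (wvR l) Λ ⊆ Λ')
    (gR : Fin nSR → β → α)
    (hgR : ∀ l b', d (gR l b') = Orb.embMap (PolySite.incl (hshR l)) (Orb.embMap (PolySite.d4Emb (γR l) (wvR l) Λ) (dΛ b')))
    (SYR : Fin nSR → Terms β) (CWR : Terms α) (hcwR : ∀ wc ∈ CWR, chargeW wc.1 ≠ 0 ∨ spinChargeW sp wc.1 ≠ 0) (AVR : List (Terms α))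
    {RR : CARPoly.Poly α}
    (hRR : evalPoly d RR = termOp d (residTG TXR μR νR o κR capR κR' flR TER TGR THR f EB gR SYR CWR AVR))
    {βR slR : ℚ} (hβR : βR ≤ lowerConst RR + (μR 0 + μR 1) * ((22 / 25 : ℚ) / 2 - νR)) (hslR : μR 0 + μR 1 = 2 * slR)
    -- multiplier signs and cut floors
    (hκP : 0 ≤ κP) (hκP' : 0 ≤ κP') (hκQ : 0 ≤ κQ) (hκQ' : 0 ≤ κQ') (hκR : 0 ≤ κR) (hκR' : 0 ≤ κR')
    (hflP : flP ≤ -124827703/50000000) (hflQ : flQ ≤ -124827703/50000000) (hflR : flR ≤ -124827703/50000000)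
    -- cell 1 = {P, Q} re-priced to the top-plane values `cP♯`, `cQ♯`: bounds, law, slot, prices
    {cPs cQs βPs βQs F₁ L₁ : ℚ}
    (hcPs : cPs = -15830689/10000000 + 3 * (121/625)) (hcQs : cQs = -15830689/10000000 + b * (121/625))
    (hβPs : βPs ≤ βP - κP * (cPs - capP)) (hβQs : βQs ≤ βQ - κQ * (cQs - capQ))
    (hL₁ : ((L₁ : ℚ) : ℝ) = (((b : ℚ) : ℝ) - 3) * max ((((κQ - κP) - (κQ' - κP') : ℚ) : ℝ) * 0)
        ((((κQ - κP) - (κQ' - κP') : ℚ) : ℝ) * (((1 / 4 : ℚ)) : ℝ)) -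
          ((((κQ - κP) * (cQs - cPs) + (κQ' - κP') * (-(flQ - flP)) : ℚ)) : ℝ))
    (hF₁v : L₁ ≤ 0 → F₁ ≤ min βPs βQs)
    (hF₁i : 0 < L₁ → ((F₁ : ℚ) : ℝ) ≤ ((βPs : ℚ) : ℝ) - (((L₁ : ℚ) : ℝ) - (((βQs : ℚ) : ℝ) - ((βPs : ℚ) : ℝ))) ^ 2 / (4 * ((L₁ : ℚ) : ℝ)))
    (p₀ : -F₁ ≤ 4767609 / 10000000) (p₁ : -F₁ - slP * (43 / 50 - 22 / 25) ≤ 4767609 / 10000000)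
    (p₂ : -F₁ - slQ * (43 / 50 - 22 / 25) ≤ 4767609 / 10000000)
    -- cell 2 = {Q, R} re-priced to the polarised constant `c`: bounds, law, slot, prices
    {c βQc βRc F₂ L₂ : ℚ} (hc₁ : (-6148940299/10000000000 : ℚ) ≤ c) (hc₂ : (-5511249107/10000000000 : ℚ) ≤ c)
    (hcU : ((c : ℚ) : ℝ) + 15861979 / 10000000 ≤ ((b : ℚ) : ℝ) / 4)
    (hβQc : βQc ≤ βQ - κQ * (c - capQ)) (hβRc : βRc ≤ βR - κR * (c - capR))
    (hL₂ : ((L₂ : ℚ) : ℝ) = (17 / 2 - ((b : ℚ) : ℝ)) * max ((((κR - κQ) - (κR' - κQ') : ℚ) : ℝ) * 0)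
        ((((κR - κQ) - (κR' - κQ') : ℚ) : ℝ) * (((1 / 4 : ℚ)) : ℝ)) -
          ((((κR - κQ) * (c - c) + (κR' - κQ') * (-(flR - flQ)) : ℚ)) : ℝ))
    (hF₂v : L₂ ≤ 0 → F₂ ≤ min βQc βRc)
    (hF₂i : 0 < L₂ → ((F₂ : ℚ) : ℝ) ≤ ((βQc : ℚ) : ℝ) - (((L₂ : ℚ) : ℝ) - (((βRc : ℚ) : ℝ) - ((βQc : ℚ) : ℝ))) ^ 2 / (4 * ((L₂ : ℚ) : ℝ)))
    (q₀ : -F₂ ≤ 4767609 / 10000000) (q₁ : -F₂ - slQ * (43 / 50 - 22 / 25) ≤ 4767609 / 10000000)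
    (q₂ : -F₂ - slR * (43 / 50 - 22 / 25) ≤ 4767609 / 10000000) :
    PatchLeftEdgeP10 := by
  -- (1) the two pinned U-pair shapes from the residual data (shared `EB`; the middle vertex `Q` serves both pairs), re-priced to the cells' caps
  have hPQ := ((SquareTTPrimePinnedPairRowU.of_residPolys_wide (3) (by norm_num) b (-49 / 100) (22 / 25) h7 hΛ h8 h0 hz d dΛ f hf sp
    hsp o ho (-oddMomentObsTT (-49 / 100) Uo 0) EB
    THP hHP TEP hEP TXP hXP μP νP κP capP κP' flP TGP hΛmP OP hGP γP wvP hshP gP hgP SYP CWP hcwP AVP hRP hβP hslP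
    THQ hHQ TEQ hEQ TXQ hXQ μQ νQ κQ capQ κQ' flQ TGQ hΛmQ OQ hGQ γQ wvQ hshQ gQ hgQ SYQ CWQ hcwQ AVQ hRQ hβQ hslQ).reprice cPs cQs).mono
    hβPs hβQs
  have hQR := ((SquareTTPrimePinnedPairRowU.of_residPolys_wide b (by linarith) (17 / 2) (-49 / 100) (22 / 25) h7 hΛ h8 h0 hz d dΛ f hf
    sp hsp o ho (-oddMomentObsTT (-49 / 100) Uo 0) EB
    THQ hHQ TEQ hEQ TXQ hXQ μQ νQ κQ capQ κQ' flQ TGQ hΛmQ OQ hGQ γQ wvQ hshQ gQ hgQ SYQ CWQ hcwQ AVQ hRQ hβQ hslQ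
    THR hHR TER hER TXR hXR μR νR κR capR κR' flR TGR hΛmR OR hGR γR wvR hshR gR hgR SYR CWR hcwR AVR hRR hβR hslR).reprice c c).mono
    hβQc hβRc
  -- (2) numerals
  have e1 : (((3 : ℚ)) : ℝ) = 3 := by norm_num
  have e2 : (((17 / 2 : ℚ)) : ℝ) = 17 / 2 := by norm_num
  have e3 : (((-49 / 100 : ℚ)) : ℝ) = -49 / 100 := by norm_num
  rw [e1, e3] at hPQ
  rw [e2, e3] at hQR
  have hb₁' : (((3 : ℚ)) : ℝ) < ((b : ℚ) : ℝ) := Rat.cast_lt.2 hb₁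
  have hb₂' : ((b : ℚ) : ℝ) < (((17 / 2 : ℚ)) : ℝ) := Rat.cast_lt.2 hb₂
  rw [e1] at hb₁'
  rw [e2] at hb₂'
  -- (3) the re-priced caps of cell 1 lie ON the top plane
  have hcP : ((-15830689/10000000 : ℚ) : ℝ) + (3 : ℝ) * ((121/625 : ℚ) : ℝ) ≤ ((cPs : ℚ) : ℝ) := by
    rw [hcPs]; push_cast; linarith
  have hcQ : ((-15830689/10000000 : ℚ) : ℝ) + ((b : ℚ) : ℝ) * ((121/625 : ℚ) : ℝ) ≤ ((cQs : ℚ) : ℝ) := by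
    rw [hcQs]; push_cast; linarith
  -- (4) the item from the two cells
  exact covHg1201M19P10_PatchLeftEdgeP10_of_pairU_twoCells hb₁' hb₂' Uo Uo hPQ hκP hκP' hκQ hκQ' hcP hcQ hflP hflQ hL₁ hF₁v hF₁i p₀ p₁ p₂
    hc₁ hc₂ hcU hQR hκQ hκQ' hκR hκR' hflQ hflR hL₂ hF₂v hF₂i q₀ q₁ q₂

end Kernel

end Summit.Ventures.CertifiedManyBodySolver.Theorems

end
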